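import Summits.QuantumFields.YangMills.Theorems.BalabanUVNodesN08HaarCompatibilityGuard

/-!
# BalabanUVNodes ∕ N08 — THE MIXTURE NORMAL FORM OF THE TYPED E6′ LETTER: `Ū_*(dU)` IS THE LAW OF THE BACKGROUND-WISE INDEPENDENT RESAMPLING
# `(U, g) ↦ (c ↦ Ū(c)(U[β(c) ↦ g_c]))` UNDER `dU ⊗ Haar^{bonds}`, so E6′ ⟺ «the MIXTURE over backgrounds of the product fibre laws is product Haar» —
# the exact form in which road (iv) (fibrewise invariance, refuted in parts 11B∕12B) differs from E6′ (undecided)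

WIDTH SEAT `pub-ymgap-dag-n08-w3` g3, plan `W-SEAT-START-LIST.md` v8 §n08 item 3 PART 13 (successor piece of part 6 p594625 `…Guard` and part 8 p597554
`…GuardReparam`), 2026-08-28.  Track A, DAG node N08 = [Balaban1985UV3] Thm 1 p. 257 (compact) + Thm 2 p. 272; key item K1⁷ `StabilityBAtRecordR13SepCoPH`
(stmt-QuantumFields-20542), `--supports … --as helper`.  COUNT-NEUTRAL.

THE POINT.  By locality of the typed (0.4) averaging in the private coordinates (`BlockAveragingHaarAC.isLocal_avgFun`: `Ū(c′)` does not see `U(β(c))`,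
`c′ ≠ c`) and pub-balaban's RESAMPLING LEMMA (`T4TriangularPushforward.measurePreserving_resample`: replacing every private coordinate `U(β(c))` by a fresh
independent Haar variable `g_c` preserves `dU`), the image law of the typed averaging is, for EVERY small-loop average `ℰ` and every group,
`Ū_*(dU) = (dU ⊗ Haar^{PBond(j+1)}) ∘ (R_ℰ)⁻¹`, `R_ℰ(U, g) := (c ↦ Ū(c)(U[β(c) ↦ g_c]))` (`map_avgFun_eq_map_resample`): conditionally on the background `U`
the coarse bonds are INDEPENDENT, bond `c` being the image of a Haar variable under the fibre map `g ↦ Ū(c)(U[β(c) ↦ g]) = corr(U[β(c) ↦ g], c) · pre · g · post`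
(`avgFun_update_centralBond`).  For the AXIAL averaging the same resampling gives `dV` exactly (`map_resample_axialAvg`, the fibre maps being the translations
`g ↦ pre · g · post`).  Hence the typed E6′ letter reads (`map_avgFun_eq_iff_map_resample`)
`Ū_*(dU) = dV ⟺ (dU ⊗ Haar^κ)∘R_ℰ⁻¹ = (dU ⊗ Haar^κ)∘R_axial⁻¹`: a statement about the MIXTURE over backgrounds of product fibre laws — whereas road (iv)
(part 8: `Ψ_*(dU) = dU`) asks the fibre laws themselves to be Haar background by background, which parts 11B∕12B REFUTE.  E6′ survives only as a possible
cancellation in the mixture; single bonds (p585871) and forests (p589866) DO cancel exactly (coarse-gauge invariance); cycles are not covered by any landed fact.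

WHAT THIS FILE PROVES ([folklore] over landed modules; nothing of Bałaban's asserted; 0 `def`).  §1 (any group, any ℰ, in range) `avgFun_update_centralBond`
(the fibre formula), ★★ `map_avgFun_eq_map_resample`, `map_resample_axialAvg` (`= dV`), ★ `map_avgFun_eq_iff_map_resample`.  §2 at the [B10] slot
`avOfPrint N S j` on `SU(N)`: `map_avOfPrint_eq_map_resample`, `map_avOfPrint_eq_iff_map_resample`, and the T-letter form for every `𝔗 : TFamily₃ N L`.

HONEST FRAMING.  A normal form; decides nothing (E6′ stays UNDECIDED; road (iv) is part 12B's); count-neutral; N08 NOT discharged; counts unmoved (typed 28∕28 ·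
discharged 5∕27); one finite 𝕋⁴ programme at fixed ε — R4 closes the CONDITIONAL rung `BalabanLadder.UV` only; the Yang–Mills mass gap (Clay) is NOT proved by
any of this; nothing continuum ∕ ℝ³ ∕ ℝ⁴ ∕ OS ∕ mass gap.  0 `sorry`, 0 `def`, 0 `instance`, standard axioms.
-/

noncomputable section

open MeasureTheory Function

namespace Summit.QuantumFields.YangMills.BalabanUVNodes.N08HaarCompatibilityGuardMixture

open Literature.MathematicalPhysics.QuantumFieldTheory.Balaban1983to89
open Literature.MathematicalPhysics.QuantumFieldTheory.Balaban1983to89.T4Continuum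
open Literature.MathematicalPhysics.QuantumFieldTheory.Balaban1983to89.AveragingRT (axialAvg map_axialAvg measurable_axialAvg)
open Literature.MathematicalPhysics.QuantumFieldTheory.Balaban1983to89.BlockAveraging (Idx loopHol Small corr avgFun avgFun_trivial measurable_avgFun)
open Literature.MathematicalPhysics.QuantumFieldTheory.Balaban1983to89.BlockAveragingHaarAC
  (centralBond centralBond_injective pre post axialAvg_update_centralBond isLocal_avgFun)
open Literature.MathematicalPhysics.QuantumFieldTheory.Balaban1983to89.T4TriangularPushforward (measurePreserving_resample apply_resample_eq)

/-! ## §1. The image law of the typed averaging is a background-wise independent resampling -/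

section Generic

variable {P : Params} {j : ℕ} {G : Type*} [GaugeGroup G] (ℰ : LoopAverage G)

/-- **THE FIBRE FORMULA**: `Ū(c)(U[β(c) ↦ g]) = corr(U[β(c) ↦ g], c) · pre(U) · g · post(U)` — bond `c` of the typed averaging as a function of its private
coordinate, the background fixed (`pre`, `post` free of it). [cite: Balaban1987RG1, (0.4) p.253 (bookkeeping)] -/
theorem avgFun_update_centralBond (hj : j + 1 ≤ P.m + P.K) (U : GaugeField P j G) (c : PBond P (j + 1)) (g : G) :
    avgFun ℰ (update U (centralBond c) g) c = corr ℰ (update U (centralBond c) g) c * (pre U c * g * post U c) := by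
  show corr ℰ _ c * axialAvg _ c = _
  rw [axialAvg_update_centralBond hj]

variable [MeasurableSpace G] [RegularGaugeGroup G] [HaarData G]

/-- **`Ū_*(dU)` IS THE LAW OF THE BACKGROUND-WISE INDEPENDENT RESAMPLING**: for every small-loop average `ℰ` with measurable `E` (standing range),
`(dU).map Ū = (dU ⊗ Haar^{PBond(j+1)}).map (U, g) ↦ (c ↦ Ū(c)(U[β(c) ↦ g_c]))` — locality in the private coordinates (`isLocal_avgFun`) + resampling
(`measurePreserving_resample`). [cite: Balaban1987RG1, (0.4) p.253 (the typed averaging; bookkeeping)] -/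
theorem map_avgFun_eq_map_resample (hj : j + 1 ≤ P.m + P.K) (hE : ∀ n, Measurable fun W : Fin (n + 1) → G => ℰ.E W) :
    (fieldMeasure P j G).map (avgFun ℰ) =
      ((fieldMeasure P j G).prod (Measure.pi fun _ : PBond P (j + 1) => (HaarData.haar : Measure G))).map
        (fun p : GaugeField P j G × (PBond P (j + 1) → G) => fun c => avgFun ℰ (update p.1 (centralBond c) (p.2 c)) c) := by
  classical
  haveI := HaarData.isProb (G := G)
  have hA := isLocal_avgFun (G := G) hj ℰ
  have hβ := centralBond_injective (P := P) (j := j) hj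
  have hres := measurePreserving_resample (ι := PBond P j) (HaarData.haar : Measure G) hβ
  have key : (fun p : GaugeField P j G × (PBond P (j + 1) → G) => fun c => avgFun ℰ (update p.1 (centralBond c) (p.2 c)) c) =
      avgFun ℰ ∘ fun p : GaugeField P j G × (PBond P (j + 1) → G) => Function.extend centralBond p.2 p.1 :=
    funext fun p => funext fun c => (apply_resample_eq hA hβ p.1 p.2 c).symm
  have h2 := Measure.map_map (μ := (Measure.pi fun _ : PBond P j => (HaarData.haar : Measure G)).prod
    (Measure.pi fun _ : PBond P (j + 1) => (HaarData.haar : Measure G))) (measurable_avgFun ℰ hE) hres.measurable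
  rw [key]
  exact ((congrArg (fun ν : Measure (GaugeField P j G) => ν.map (avgFun ℰ)) hres.map_eq).symm.trans h2)

/-- **FOR THE AXIAL AVERAGING THE RESAMPLING GIVES `dV` EXACTLY** (its fibre maps are the translations `g ↦ pre · g · post`; `axial_*(dU) = dV`,
`AveragingRT.map_axialAvg`). [cite: Balaban1987RG1, (0.4) p.253 (bookkeeping)] -/
theorem map_resample_axialAvg (hj : j + 1 ≤ P.m + P.K) :
    ((fieldMeasure P j G).prod (Measure.pi fun _ : PBond P (j + 1) => (HaarData.haar : Measure G))).map
        (fun p : GaugeField P j G × (PBond P (j + 1) → G) => fun c => axialAvg (update p.1 (centralBond c) (p.2 c)) c) =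
      fieldMeasure P (j + 1) G := by
  have h := map_avgFun_eq_map_resample (LoopAverage.trivial G) hj (fun _ => measurable_const) (P := P) (j := j)
  have htriv : (avgFun (LoopAverage.trivial G) : GaugeField P j G → GaugeField P (j + 1) G) = axialAvg := funext fun U => avgFun_trivial U
  simp only [htriv] at h
  rw [map_axialAvg hj] at h
  exact h.symm

/-- **THE MIXTURE NORMAL FORM OF THE TYPED E6′ LETTER**: `Ū_*(dU) = dV ⟺ (dU ⊗ Haar^κ)∘R_ℰ⁻¹ = (dU ⊗ Haar^κ)∘R_axial⁻¹` — the mixture over backgrounds of the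
product fibre laws of `ℰ`'s averaging must equal that of the axial one (which is `dV`).  Road (iv) asked instead for equality FIBRE BY FIBRE.
[cite: Balaban1987RG1, (0.4) p.253 (bookkeeping; E6′ NOT IN PRINT, not decided here)] -/
theorem map_avgFun_eq_iff_map_resample (hj : j + 1 ≤ P.m + P.K) (hE : ∀ n, Measurable fun W : Fin (n + 1) → G => ℰ.E W) :
    (fieldMeasure P j G).map (avgFun ℰ) = fieldMeasure P (j + 1) G ↔
      ((fieldMeasure P j G).prod (Measure.pi fun _ : PBond P (j + 1) => (HaarData.haar : Measure G))).map
          (fun p : GaugeField P j G × (PBond P (j + 1) → G) => fun c => avgFun ℰ (update p.1 (centralBond c) (p.2 c)) c) =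
        ((fieldMeasure P j G).prod (Measure.pi fun _ : PBond P (j + 1) => (HaarData.haar : Measure G))).map
          (fun p : GaugeField P j G × (PBond P (j + 1) → G) => fun c => axialAvg (update p.1 (centralBond c) (p.2 c)) c) := by
  rw [map_avgFun_eq_map_resample ℰ hj hE, map_resample_axialAvg hj]
  exact Iff.rfl

end Generic

/-! ## §2. At the [B10] slot's averaging `avOfPrint N S j` on `SU(N)` -/

section Slot

open Literature.MathematicalPhysics.QuantumFieldTheory.Balaban1985CMP102.Setting (Scales)
open Literature.MathematicalPhysics.QuantumFieldTheory.Balaban1983to89.B10RunsOfRecord (avOfPrint)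
open Literature.MathematicalPhysics.QuantumFieldTheory.Balaban1983to89.B10Eq2HaarCompatibility (map_avOfPrint_eq_iff)
open ExpMeanLog (expMeanLogSU measurable_expMeanLogSU_E)
open Literature.MathematicalPhysics.QuantumFieldTheory.Balaban1983to89.Node00 (SU TFamily₃)
open Summit.QuantumFields.YangMills.BalabanUVNodes.N08HaarCompatibilityGuard (avOfPrint_avg_of_le)

variable (N : ℕ) [NeZero N] {L : ℕ}

/-- **AT THE SLOT: `(avOfPrint)_*(dU)` is the law of the background-wise independent resampling** (every `N`, in range).
[cite: Balaban1985UV3, (2) p.256; Balaban1987RG1, (0.4) p.253 (bookkeeping)] -/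
theorem map_avOfPrint_eq_map_resample (S : Scales L) {j : ℕ} (hj : j + 1 ≤ S.P.m + S.P.K) :
    (fieldMeasure S.P j (SU N)).map (avOfPrint N S j).avg =
      ((fieldMeasure S.P j (SU N)).prod (Measure.pi fun _ : PBond S.P (j + 1) => (HaarData.haar : Measure (SU N)))).map
        (fun p : GaugeField S.P j (SU N) × (PBond S.P (j + 1) → SU N) => fun c =>
          avgFun (expMeanLogSU : LoopAverage (SU N)) (update p.1 (centralBond c) (p.2 c)) c) := by
  rw [avOfPrint_avg_of_le N S hj]
  exact map_avgFun_eq_map_resample _ hj measurable_expMeanLogSU_E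

/-- **E6′ AT THE SLOT IN MIXTURE NORMAL FORM** (every `N`, in range): `(avOfPrint)_*(dU) = dV ⟺` the two resampled laws coincide.
[cite: Balaban1985UV3, (2) p.256; Balaban1987RG1, (0.4) p.253 (bookkeeping; E6′ NOT IN PRINT, not decided here)] -/
theorem map_avOfPrint_eq_iff_map_resample (S : Scales L) {j : ℕ} (hj : j + 1 ≤ S.P.m + S.P.K) :
    (fieldMeasure S.P j (SU N)).map (avOfPrint N S j).avg = fieldMeasure S.P (j + 1) (SU N) ↔
      ((fieldMeasure S.P j (SU N)).prod (Measure.pi fun _ : PBond S.P (j + 1) => (HaarData.haar : Measure (SU N)))).map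
          (fun p : GaugeField S.P j (SU N) × (PBond S.P (j + 1) → SU N) => fun c =>
            avgFun (expMeanLogSU : LoopAverage (SU N)) (update p.1 (centralBond c) (p.2 c)) c) =
        ((fieldMeasure S.P j (SU N)).prod (Measure.pi fun _ : PBond S.P (j + 1) => (HaarData.haar : Measure (SU N)))).map
          (fun p : GaugeField S.P j (SU N) × (PBond S.P (j + 1) → SU N) => fun c => axialAvg (update p.1 (centralBond c) (p.2 c)) c) := by
  rw [avOfPrint_avg_of_le N S hj]
  exact map_avgFun_eq_iff_map_resample _ hj measurable_expMeanLogSU_E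

variable (L) in
/-- … in the T-letters: for EVERY transformation family `𝔗 : Node00.TFamily₃ N L`, `(𝔗 S j).T 1 =ᵐ 1 ⟺` the two resampled laws coincide (p434996
`map_avOfPrint_eq_iff`). [cite: Balaban1985Averaging, (10) p.19; Balaban1987RG1, (0.4) p.253 (bookkeeping; «T1 = 1» NOT IN PRINT)] -/
theorem TFamily_one_ae_eq_one_iff_map_resample (𝔗 : TFamily₃ N L) (S : Scales L) {j : ℕ} (hj : j + 1 ≤ S.P.m + S.P.K) :
    (𝔗 S j).T 1 =ᵐ[fieldMeasure S.P (j + 1) (SU N)] 1 ↔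
      ((fieldMeasure S.P j (SU N)).prod (Measure.pi fun _ : PBond S.P (j + 1) => (HaarData.haar : Measure (SU N)))).map
          (fun p : GaugeField S.P j (SU N) × (PBond S.P (j + 1) → SU N) => fun c =>
            avgFun (expMeanLogSU : LoopAverage (SU N)) (update p.1 (centralBond c) (p.2 c)) c) =
        ((fieldMeasure S.P j (SU N)).prod (Measure.pi fun _ : PBond S.P (j + 1) => (HaarData.haar : Measure (SU N)))).map
          (fun p : GaugeField S.P j (SU N) × (PBond S.P (j + 1) → SU N) => fun c => axialAvg (update p.1 (centralBond c) (p.2 c)) c) := by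
  rw [← map_avOfPrint_eq_iff N S j 𝔗]
  exact map_avOfPrint_eq_iff_map_resample N S hj

end Slot

end Summit.QuantumFields.YangMills.BalabanUVNodes.N08HaarCompatibilityGuardMixture

end
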